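import Summits.QuantumFields.BalabanUV.T4Continuum.Support.NE3ProductPathSizes
import Summits.QuantumFields.BalabanUV.T4Continuum.Support.NE3CurlReverseReading
import HarnessLib

/-!
# T⁴ programme, node NE3, route Π, file 3b part 2 — THE MOVING PLAQUETTE RADIUS OF THE PRODUCT PATH (`DecomposedRep.small`) FROM THE
# CURLS OF ITS DATA: `a ≤ 2x_W + x_A + 2a_N + 4δ + 48α₀² + 92(α+α_N)² + 144(α+α_N)(e^{6(α+α_N)} − 1)`

NE3 formalisation swarm `b2b-balaban-t4-ne3-formalise-*`, LEAF PROVER 04 (gen 7); the owner's design note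
`HOME/t4/b2b-balaban-t4-ne3-p1/g25/D-ne3p1-g25-1.md` §3 «the plaquette radius `a` of the product path (field `small`)» and §4 row 3b
(«OFFER → leaf-04-g7»); INTENT HOME/CLAIMS.log l.22798.  Part 1 = `NE3CurlReverseReading` (the reverse curl reading).

WHAT.  For a unitary background `W`, the product path `Γ_t = pathΓ X N t` (`NE3ProductPath`: `Γ_t(b) = skewHalf (log (e^{(1−t)²N(b)} e^{(t−1)X(b)}))`)
of the decomposed representative `U_A^u = W·e^{N}·e^{−X}` moves the plaquette variables of `W` by at most the dressed curls of its data: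
§2 THE CURL OF THE PRODUCT PATH: `isSkewDir_real_smul`, the rescaling identity **`pathΓ_rescale`** (`Γ_t[X, N] = Γ_0[(1−t)X, (1−t)²N]`), the
   linearisation **`norm_pathΓ_sub_lin_le`** (`‖Γ_t(b) − ((1−t)²N(b) − (1−t)X(b))‖ ≤ 23(α+α_N)(‖N(b)‖ + ‖X(b)‖)` on `[0,1]`, from the owner's
   `NE3ProductPathSizes.norm_pathΓ_zero_sub_le` at the rescaled data), and **`norm_curlAt_pathΓ_le`**
   (`‖(d_W Γ_t)(p)‖ ≤ (1−t)²‖(d_W N)(p)‖ + (1−t)‖(d_W X)(p)‖ + 92(α+α_N)²`);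
§3 THE RADIUS **`norm_fhol_vary_pathΓ_sub_one_le`** — window radii `x_W` of `W` and window curl bounds `c_N`, `c_X` give, for every `t ∈ [0,1]` and
   every plaquette of the window, `‖(W e^{Γ_t})(∂p) − 1‖ ≤ x_W + c_N + c_X + 92(α+α_N)² + 144(α+α_N)(e^{6(α+α_N)} − 1)` (leaf-03's
   `norm_fhol_vary_sub_one_le_curl` at parameter `1`, sup-radius `6(α+α_N)` of the path = the owner's `norm_pathΓ_le`), and the polynomial form
   **`norm_fhol_vary_pathΓ_sub_one_le_poly`** (`… + 1300(α+α_N)²`);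
§4 THE OWNER's LETTER FORM **`small_of_residual_data`**: residual field `X₀` (`U_A^u = W e^{X₀}`, `ResidualSliceRep.rep`), linear normal part `Nn`,
   tangent datum `X = Nn − X₀`, normal part `N` with `‖N(b) − Nn(b)‖ ≤ δ` (the owner's `norm_normalPart_sub_le`: `δ = 2048(α₀+α_N)·α_N`), window
   radii `x_W` (`W`), `x_A` (`W e^{X₀}`) and window sup-curl `a_N` of `Nn` (Π-R's (R6′)):
   `‖(W e^{Γ_t})(∂p) − 1‖ ≤ 2x_W + x_A + 2a_N + 4δ + 48α₀² + 92(α+α_N)² + 144(α+α_N)(e^{6(α+α_N)} − 1)` = the design note's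
   `a ≤ 2x_W + x_A + 2a_N + C′(α₀+α_N)²` with `C′` displayed (reverse reading of part 1 for `d_W X₀`, linearity of `d_W` for `X = Nn − X₀` and
   `N = Nn + (N − Nn)`); polynomial form **`small_of_residual_data_poly`** (`… + 48α₀² + 1300(α+α_N)²`).
The plaquette window `Wn` is an ARBITRARY `Finset` (everything is plaquette-local); the consumer takes `Wn = perWin d (N·L^k)`.

HONEST FRAMING.  Elementary plaquette bookkeeping on OUR frame; `DecomposedRep`, `ResidualSliceRep`, the (Π-REG) leaf are NOT imported — the owner
instantiates §4 in files 2∕3a of D-ne3p1-g25-1 §4; `a_N` is Π-R's sup-curl letter (R6′), asserted here for nothing.  Nothing about Bałaban's minimisers;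
the THREE SIZES, T-E_w♯, NE3 NOT proved; spine PROVED 0∕9; finite T⁴ rung (B)+1 — NOT infinite volume, NOT mass gap, NOT BetaPertH, NOT Clay.
ABSOLUTE RULE kept (context only: [Balaban1985Variational] Prop. 2∕3 pp. 281∕289; [Balaban1985Averaging] (44) p. 24).  PLACEMENT:
`Summits/QuantumFields/BalabanUV/`.  HONEST DEPENDENCY: continuum YM on T⁴ ⇐ BetaPertH ∧ nine spine estimates (0/9 proved); BetaPertH ⇐ (D1) ∧ (D4)
∧ CAP+tail; G-an2-4 gates asym, D1 and NE2/3/4.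
-/

set_option autoImplicit false

open scoped BigOperators Matrix.Norms.L2Operator
open NormedSpace Finset Set

namespace Summit.QuantumFields.BalabanUV.T4Continuum.NE3ProductPathPlaquettes

open Literature.MathematicalPhysics.QuantumFieldTheory.Balaban1983to89
open B7Prop1Explicit B7Prop2Explicit MatrixLog UnitaryModel
open T4AveragingDeficitWall (IsSkewDir IsUnitaryCfg vary vary_zero Ad curl curlAt fhol)
open NE3HessBounds (norm_curlAt_le)
open NE3EnergySmallFieldCurl (norm_fhol_vary_sub_one_le_curl)
open NE3ProductPath (prodM expN expX skewHalf pathΓ isSkewDir_pathΓ)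
open NE3ProductPathSizes (norm_pathΓ_le norm_pathΓ_zero_sub_le)
open NE3CurlReverseReading (one_sub_mul_exp_le_one curlAt_lincomb norm_curl_le_of_radii)

noncomputable section

variable {d : ℕ} {n : Type*} [Fintype n] [DecidableEq n]

/-! ## §2 The curl of the product path -/

omit [Fintype n] [DecidableEq n] in
/-- Real multiples of a skew direction are skew. [folklore] -/
theorem isSkewDir_real_smul {X : Site d → Fin d → Matrix n n ℂ} (hX : IsSkewDir X) (c : ℝ) :
    IsSkewDir (fun x μ => ((c : ℝ) : ℂ) • X x μ) := by
  intro x μ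
  show (((c : ℝ) : ℂ) • X x μ) ∈ skewAdjoint (Matrix n n ℂ)
  rw [Complex.coe_smul]
  exact skewAdjoint.smul_mem c (hX x μ)

/-- **THE RESCALING IDENTITY OF THE PRODUCT PATH**: `Γ_t[X, N] = Γ_0[(1−t)•X, (1−t)²•N]` (both are
`skewHalf (log (e^{(1−t)²N} e^{−(1−t)X}))` bondwise). [folklore] -/
theorem pathΓ_rescale (X N : Site d → Fin d → Matrix n n ℂ) (t : ℝ) :
    pathΓ X N t = pathΓ (fun x μ => (((1 - t) : ℝ) : ℂ) • X x μ) (fun x μ => ((((1 - t) ^ 2) : ℝ) : ℂ) • N x μ) 0 := by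
  funext x μ
  have h1 : ((((1:ℝ) - 0) ^ 2 : ℝ) : ℂ) • (((((1 - t) ^ 2 : ℝ)) : ℂ) • N x μ) = ((((1 - t) ^ 2 : ℝ)) : ℂ) • N x μ := by
    rw [sub_zero, one_pow, Complex.ofReal_one, one_smul]
  have h2 : ((((0:ℝ) - 1) : ℝ) : ℂ) • ((((1 - t) : ℝ) : ℂ) • X x μ) = (((t - 1 : ℝ)) : ℂ) • X x μ := by
    rw [smul_smul, ← Complex.ofReal_mul]
    congr 1
    push_cast
    ring
  simp only [pathΓ, prodM, expN, expX, h1, h2]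

/-- **THE PATH vs ITS LINEAR PART** on `[0,1]`: `‖Γ_t(b) − ((1−t)²N(b) − (1−t)X(b))‖ ≤ 23(α+α_N)(‖N(b)‖ + ‖X(b)‖)` for skew data with
`‖X(b)‖ ≤ α ≤ 1∕32`, `‖N(b)‖ ≤ α_N ≤ 1∕64` (the owner's start-of-path bound at the rescaled data). [folklore] -/
theorem norm_pathΓ_sub_lin_le {X N : Site d → Fin d → Matrix n n ℂ} (hXs : IsSkewDir X) (hNs : IsSkewDir N) {α αN : ℝ}
    (hXα : ∀ x μ, ‖X x μ‖ ≤ α) (hNα : ∀ x μ, ‖N x μ‖ ≤ αN) (hα : α ≤ 1 / 32) (hαN : αN ≤ 1 / 64) {t : ℝ} (ht : t ∈ Icc (0:ℝ) 1)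
    (x : Site d) (μ : Fin d) :
    ‖pathΓ X N t x μ - (((((1 - t) ^ 2) : ℝ) : ℂ) • N x μ - (((1 - t) : ℝ) : ℂ) • X x μ)‖
      ≤ 23 * (α + αN) * (‖N x μ‖ + ‖X x μ‖) := by
  have hs0 : 0 ≤ 1 - t := by linarith [ht.2]
  have hs1 : 1 - t ≤ 1 := by linarith [ht.1]
  set X' : Site d → Fin d → Matrix n n ℂ := fun x μ => (((1 - t) : ℝ) : ℂ) • X x μ with hX'
  set N' : Site d → Fin d → Matrix n n ℂ := fun x μ => ((((1 - t) ^ 2) : ℝ) : ℂ) • N x μ with hN'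
  have hnX' : ∀ x μ, ‖X' x μ‖ ≤ ‖X x μ‖ := fun x μ => by
    rw [hX', norm_smul, Complex.norm_real, Real.norm_eq_abs, abs_of_nonneg hs0]
    exact mul_le_of_le_one_left (norm_nonneg _) hs1
  have hnN' : ∀ x μ, ‖N' x μ‖ ≤ ‖N x μ‖ := fun x μ => by
    rw [hN', norm_smul, Complex.norm_real, Real.norm_eq_abs, abs_of_nonneg (sq_nonneg _)]
    exact mul_le_of_le_one_left (norm_nonneg _) (by nlinarith)
  have hX'α : ∀ x μ, ‖X' x μ‖ ≤ α := fun x μ => (hnX' x μ).trans (hXα x μ)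
  have hN'α : ∀ x μ, ‖N' x μ‖ ≤ αN := fun x μ => (hnN' x μ).trans (hNα x μ)
  have h := norm_pathΓ_zero_sub_le (isSkewDir_real_smul hXs (1 - t)) (isSkewDir_real_smul hNs ((1 - t) ^ 2)) hX'α hN'α hα hαN x μ
  rw [pathΓ_rescale X N t]
  have hα0 : 0 ≤ α := (norm_nonneg _).trans (hXα x μ)
  have hαN0 : 0 ≤ αN := (norm_nonneg _).trans (hNα x μ)
  calc ‖pathΓ X' N' 0 x μ - (N' x μ - X' x μ)‖ ≤ 23 * (α + αN) * (‖N' x μ‖ + ‖X' x μ‖) := h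
    _ ≤ 23 * (α + αN) * (‖N x μ‖ + ‖X x μ‖) := by
        have : 0 ≤ 23 * (α + αN) := by positivity
        exact mul_le_mul_of_nonneg_left (add_le_add (hnN' x μ) (hnX' x μ)) this

/-- **THE CURL OF THE PRODUCT PATH**: for a unitary background and skew data as above, on `[0,1]`,
`‖(d_W Γ_t)(p′)‖ ≤ (1−t)²‖(d_W N)(p′)‖ + (1−t)‖(d_W X)(p′)‖ + 92(α+α_N)²` (linearity of the dressed curl + `Σ_{b⊂∂p′}` of §2's linearisation
error, each `≤ 23(α+α_N)²`). [folklore] -/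
theorem norm_curlAt_pathΓ_le {W : Site d → Fin d → (Matrix n n ℂ)ˣ} (hW : IsUnitaryCfg W) {X N : Site d → Fin d → Matrix n n ℂ}
    (hXs : IsSkewDir X) (hNs : IsSkewDir N) {α αN : ℝ} (hXα : ∀ x μ, ‖X x μ‖ ≤ α) (hNα : ∀ x μ, ‖N x μ‖ ≤ αN) (hα : α ≤ 1 / 32)
    (hαN : αN ≤ 1 / 64) {t : ℝ} (ht : t ∈ Icc (0:ℝ) 1) (z : Site d) (μ ν : Fin d) :
    ‖curlAt W (pathΓ X N t) z μ ν‖ ≤ (1 - t) ^ 2 * ‖curlAt W N z μ ν‖ + (1 - t) * ‖curlAt W X z μ ν‖ + 92 * (α + αN) ^ 2 := by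
  have hs0 : 0 ≤ 1 - t := by linarith [ht.2]
  have hα0 : 0 ≤ α := (norm_nonneg _).trans (hXα z μ)
  have hαN0 : 0 ≤ αN := (norm_nonneg _).trans (hNα z μ)
  set E : Site d → Fin d → Matrix n n ℂ :=
    fun x κ => pathΓ X N t x κ - (((((1 - t) ^ 2) : ℝ) : ℂ) • N x κ - (((1 - t) : ℝ) : ℂ) • X x κ) with hE
  have hF : ∀ (x : Site d) (κ : Fin d),
      pathΓ X N t x κ = ((((1 - t) ^ 2) : ℝ) : ℂ) • N x κ - (((1 - t) : ℝ) : ℂ) • X x κ + E x κ := fun x κ => by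
    simp only [hE, add_sub_cancel]
  rw [curlAt_lincomb W _ _ N X E (pathΓ X N t) hF z μ ν]
  have hEb : ∀ x κ, ‖E x κ‖ ≤ 23 * (α + αN) * (αN + α) := fun x κ => by
    have h := norm_pathΓ_sub_lin_le hXs hNs hXα hNα hα hαN ht x κ
    refine h.trans ?_
    have : 0 ≤ 23 * (α + αN) := by positivity
    exact mul_le_mul_of_nonneg_left (add_le_add (hNα x κ) (hXα x κ)) this
  have hcE : ‖curlAt W E z μ ν‖ ≤ 92 * (α + αN) ^ 2 := by
    have h := norm_curlAt_le hW E z μ ν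
    have := hEb z μ; have := hEb (z + e μ) ν; have := hEb (z + e ν) μ; have := hEb z ν
    nlinarith
  have hn1 : ‖((((1 - t) ^ 2 : ℝ)) : ℂ) • curlAt W N z μ ν‖ = (1 - t) ^ 2 * ‖curlAt W N z μ ν‖ := by
    rw [norm_smul, Complex.norm_real, Real.norm_eq_abs, abs_of_nonneg (sq_nonneg _)]
  have hn2 : ‖(((1 - t : ℝ)) : ℂ) • curlAt W X z μ ν‖ = (1 - t) * ‖curlAt W X z μ ν‖ := by
    rw [norm_smul, Complex.norm_real, Real.norm_eq_abs, abs_of_nonneg hs0]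
  calc ‖((((1 - t) ^ 2 : ℝ)) : ℂ) • curlAt W N z μ ν - (((1 - t : ℝ)) : ℂ) • curlAt W X z μ ν + curlAt W E z μ ν‖
      ≤ ‖((((1 - t) ^ 2 : ℝ)) : ℂ) • curlAt W N z μ ν‖ + ‖(((1 - t : ℝ)) : ℂ) • curlAt W X z μ ν‖ + ‖curlAt W E z μ ν‖ :=
        (norm_add_le _ _).trans (add_le_add (norm_sub_le _ _) le_rfl)
    _ ≤ (1 - t) ^ 2 * ‖curlAt W N z μ ν‖ + (1 - t) * ‖curlAt W X z μ ν‖ + 92 * (α + αN) ^ 2 := by rw [hn1, hn2]; linarith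

/-! ## §3 The moving plaquette radius of the product path -/

/-- **THE MOVING PLAQUETTE RADIUS OF THE PRODUCT PATH.**  Unitary `W`, skew data `X`, `N` with `‖X(b)‖ ≤ α ≤ 1∕32`, `‖N(b)‖ ≤ α_N ≤ 1∕64`; on a
plaquette window `Wn`: radii `‖W(∂p) − 1‖ ≤ x_W` and curl bounds `‖(d_W N)(p)‖ ≤ c_N`, `‖(d_W X)(p)‖ ≤ c_X`.  Then for every `t ∈ [0,1]` and every
`p ∈ Wn`: `‖(W e^{Γ_t})(∂p) − 1‖ ≤ x_W + c_N + c_X + 92(α+α_N)² + 144(α+α_N)(e^{6(α+α_N)} − 1)`. [folklore] -/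
theorem norm_fhol_vary_pathΓ_sub_one_le [Nonempty n] {W : Site d → Fin d → (Matrix n n ℂ)ˣ} (hW : IsUnitaryCfg W)
    {X N : Site d → Fin d → Matrix n n ℂ} (hXs : IsSkewDir X) (hNs : IsSkewDir N) {α αN : ℝ} (hXα : ∀ x μ, ‖X x μ‖ ≤ α)
    (hNα : ∀ x μ, ‖N x μ‖ ≤ αN) (hα : α ≤ 1 / 32) (hαN : αN ≤ 1 / 64) (Wn : Finset (T4AveragingDeficitWall.Plaq d)) {xW cN cX : ℝ}
    (hxW : ∀ p ∈ Wn, ‖((fhol W p : (Matrix n n ℂ)ˣ) : Matrix n n ℂ) - 1‖ ≤ xW) (hcN : ∀ p ∈ Wn, ‖curl W N p‖ ≤ cN)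
    (hcX : ∀ p ∈ Wn, ‖curl W X p‖ ≤ cX) {t : ℝ} (ht : t ∈ Icc (0:ℝ) 1) :
    ∀ p ∈ Wn, ‖((fhol (vary W (pathΓ X N t) 1) p : (Matrix n n ℂ)ˣ) : Matrix n n ℂ) - 1‖
      ≤ xW + cN + cX + 92 * (α + αN) ^ 2 + 144 * (α + αN) * (Real.exp (6 * (α + αN)) - 1) := by
  intro p hp
  have hα0 : 0 ≤ α := (norm_nonneg _).trans (hXα p.1 p.2.1.1)
  have hαN0 : 0 ≤ αN := (norm_nonneg _).trans (hNα p.1 p.2.1.1)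
  have hs0 : 0 ≤ 1 - t := by linarith [ht.2]
  have hs1 : 1 - t ≤ 1 := by linarith [ht.1]
  -- sup radius and window curl bound of the direction `Γ_t`
  have hΓα : ∀ x κ, ‖pathΓ X N t x κ‖ ≤ 6 * (α + αN) := fun x κ => norm_pathΓ_le hXs hNs hXα hNα hα hαN ht x κ
  have hγ : ∀ q ∈ Wn, ‖curl W (pathΓ X N t) q‖ ≤ cN + cX + 92 * (α + αN) ^ 2 := by
    intro q hq
    have h := norm_curlAt_pathΓ_le hW hXs hNs hXα hNα hα hαN ht q.1 q.2.1.1 q.2.1.2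
    have h1 : ‖curlAt W N q.1 q.2.1.1 q.2.1.2‖ ≤ cN := hcN q hq
    have h2 : ‖curlAt W X q.1 q.2.1.1 q.2.1.2‖ ≤ cX := hcX q hq
    have h0N := norm_nonneg (curlAt W N q.1 q.2.1.1 q.2.1.2)
    have h0X := norm_nonneg (curlAt W X q.1 q.2.1.1 q.2.1.2)
    have hsq : (1 - t) ^ 2 ≤ 1 := by nlinarith
    have h3 : (1 - t) ^ 2 * ‖curlAt W N q.1 q.2.1.1 q.2.1.2‖ ≤ cN :=
      ((mul_le_mul_of_nonneg_right hsq h0N).trans (by rw [one_mul])).trans h1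
    have h4 : (1 - t) * ‖curlAt W X q.1 q.2.1.1 q.2.1.2‖ ≤ cX :=
      ((mul_le_mul_of_nonneg_right hs1 h0X).trans (by rw [one_mul])).trans h2
    show ‖curlAt W (pathΓ X N t) q.1 q.2.1.1 q.2.1.2‖ ≤ _
    linarith
  have h := norm_fhol_vary_sub_one_le_curl hW (isSkewDir_pathΓ X N t) hΓα Wn hγ hxW zero_le_one p hp
  have e1 : (1:ℝ) * (6 * (α + αN)) = 6 * (α + αN) := one_mul _
  rw [e1] at h
  linarith

/-- **POLYNOMIAL FORM**: `… ≤ x_W + c_N + c_X + 1300(α+α_N)²` (`6(α+α_N) ≤ 9∕32`, `e^{x} − 1 ≤ xe^x`, `e^{9∕32} ≤ 32∕23`). [folklore] -/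
theorem norm_fhol_vary_pathΓ_sub_one_le_poly [Nonempty n] {W : Site d → Fin d → (Matrix n n ℂ)ˣ} (hW : IsUnitaryCfg W)
    {X N : Site d → Fin d → Matrix n n ℂ} (hXs : IsSkewDir X) (hNs : IsSkewDir N) {α αN : ℝ} (hXα : ∀ x μ, ‖X x μ‖ ≤ α)
    (hNα : ∀ x μ, ‖N x μ‖ ≤ αN) (hα : α ≤ 1 / 32) (hαN : αN ≤ 1 / 64) (Wn : Finset (T4AveragingDeficitWall.Plaq d)) {xW cN cX : ℝ}
    (hxW : ∀ p ∈ Wn, ‖((fhol W p : (Matrix n n ℂ)ˣ) : Matrix n n ℂ) - 1‖ ≤ xW) (hcN : ∀ p ∈ Wn, ‖curl W N p‖ ≤ cN)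
    (hcX : ∀ p ∈ Wn, ‖curl W X p‖ ≤ cX) {t : ℝ} (ht : t ∈ Icc (0:ℝ) 1) :
    ∀ p ∈ Wn, ‖((fhol (vary W (pathΓ X N t) 1) p : (Matrix n n ℂ)ˣ) : Matrix n n ℂ) - 1‖ ≤ xW + cN + cX + 1300 * (α + αN) ^ 2 := by
  intro p hp
  have h := norm_fhol_vary_pathΓ_sub_one_le hW hXs hNs hXα hNα hα hαN Wn hxW hcN hcX ht p hp
  have hα0 : 0 ≤ α := (norm_nonneg _).trans (hXα p.1 p.2.1.1)
  have hαN0 : 0 ≤ αN := (norm_nonneg _).trans (hNα p.1 p.2.1.1)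
  set b := α + αN with hb
  have hb0 : 0 ≤ b := by rw [hb]; positivity
  have hb1 : 6 * b ≤ 9 / 32 := by rw [hb]; linarith
  have he2 : (1 - 6 * b) * Real.exp (6 * b) ≤ 1 := one_sub_mul_exp_le_one (6 * b)
  have he1 : Real.exp (6 * b) - 1 ≤ (6 * b) * Real.exp (6 * b) := by nlinarith
  have he3 : Real.exp (6 * b) ≤ 32 / 23 := by nlinarith [Real.exp_pos (6 * b)]
  have htail : 144 * b * (Real.exp (6 * b) - 1) ≤ 1208 * b ^ 2 := by
    have h1 : 144 * b * (Real.exp (6 * b) - 1) ≤ 144 * b * ((6 * b) * Real.exp (6 * b)) :=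
      mul_le_mul_of_nonneg_left he1 (by positivity)
    nlinarith [Real.exp_pos (6 * b), sq_nonneg b]
  linarith

/-! ## §4 The owner's letter form: radii of the pair, sup-curl of the linear normal part -/

/-- **`DecomposedRep.small` FROM RESIDUAL DATA** (D-ne3p1-g25-1 §3).  Unitary `W`; skew residual field `X₀` (`U_A^u = W e^{X₀}`), linear normal part
`Nn`, tangent datum `X = Nn − X₀` (skew), normal part `N` (skew) with `‖N(b) − Nn(b)‖ ≤ δ`; sup bounds `‖X₀(b)‖ ≤ α₀ ≤ 1∕32`, `‖X(b)‖ ≤ α ≤ 1∕32`,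
`‖N(b)‖ ≤ α_N ≤ 1∕64`; on the window: `‖W(∂p) − 1‖ ≤ x_W`, `‖(W e^{X₀})(∂p) − 1‖ ≤ x_A`, `‖(d_W Nn)(p)‖ ≤ a_N`.  Then for all `t ∈ [0,1]`, `p ∈ Wn`:
`‖(W e^{Γ_t})(∂p) − 1‖ ≤ 2x_W + x_A + 2a_N + 4δ + 48α₀² + 92(α+α_N)² + 144(α+α_N)(e^{6(α+α_N)} − 1)`. [folklore] -/
theorem small_of_residual_data [Nonempty n] {W : Site d → Fin d → (Matrix n n ℂ)ˣ} (hW : IsUnitaryCfg W)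
    {X₀ Nn X N : Site d → Fin d → Matrix n n ℂ} (hX₀s : IsSkewDir X₀) (hXs : IsSkewDir X) (hNs : IsSkewDir N)
    (hXdef : ∀ (x : Site d) (μ : Fin d), X x μ = Nn x μ - X₀ x μ) {δ : ℝ} (hNN : ∀ (x : Site d) (μ : Fin d), ‖N x μ - Nn x μ‖ ≤ δ)
    {α₀ α αN : ℝ} (hX₀α : ∀ x μ, ‖X₀ x μ‖ ≤ α₀) (hα₀ : α₀ ≤ 1 / 32) (hXα : ∀ x μ, ‖X x μ‖ ≤ α) (hNα : ∀ x μ, ‖N x μ‖ ≤ αN)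
    (hα : α ≤ 1 / 32) (hαN : αN ≤ 1 / 64) (Wn : Finset (T4AveragingDeficitWall.Plaq d)) {xW xA aN : ℝ}
    (hxW : ∀ p ∈ Wn, ‖((fhol W p : (Matrix n n ℂ)ˣ) : Matrix n n ℂ) - 1‖ ≤ xW)
    (hxA : ∀ p ∈ Wn, ‖((fhol (vary W X₀ 1) p : (Matrix n n ℂ)ˣ) : Matrix n n ℂ) - 1‖ ≤ xA)
    (haN : ∀ p ∈ Wn, ‖curl W Nn p‖ ≤ aN) {t : ℝ} (ht : t ∈ Icc (0:ℝ) 1) :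
    ∀ p ∈ Wn, ‖((fhol (vary W (pathΓ X N t) 1) p : (Matrix n n ℂ)ˣ) : Matrix n n ℂ) - 1‖
      ≤ 2 * xW + xA + 2 * aN + 4 * δ + 48 * α₀ ^ 2 + 92 * (α + αN) ^ 2 + 144 * (α + αN) * (Real.exp (6 * (α + αN)) - 1) := by
  -- window curl bound of the tangent datum `X = Nn − X₀` by the reverse reading
  have hcX : ∀ p ∈ Wn, ‖curl W X p‖ ≤ aN + (xA + xW + 48 * α₀ ^ 2) := by
    intro p hp
    have e1 : curl W X p = curl W Nn p - curl W X₀ p := by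
      show curlAt W X p.1 p.2.1.1 p.2.1.2 = curlAt W Nn p.1 p.2.1.1 p.2.1.2 - curlAt W X₀ p.1 p.2.1.1 p.2.1.2
      have h := curlAt_lincomb W 1 1 Nn X₀ (fun _ _ => 0) X (fun x μ => by rw [hXdef, one_smul, one_smul, add_zero]) p.1 p.2.1.1 p.2.1.2
      rw [h, one_smul, one_smul]
      have h0 : curlAt W (fun (_ : Site d) (_ : Fin d) => (0 : Matrix n n ℂ)) p.1 p.2.1.1 p.2.1.2 = 0 := by
        simp only [curlAt, Ad, Matrix.mul_zero, Matrix.zero_mul, add_zero, sub_self]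
      rw [h0, add_zero]
    rw [e1]
    have h0 := norm_curl_le_of_radii hW hX₀s hX₀α hα₀ p (hxA p hp) (hxW p hp)
    exact (norm_sub_le _ _).trans (add_le_add (haN p hp) h0)
  -- window curl bound of the normal part `N = Nn + (N − Nn)`
  have hcN : ∀ p ∈ Wn, ‖curl W N p‖ ≤ aN + 4 * δ := by
    intro p hp
    set R : Site d → Fin d → Matrix n n ℂ := fun x μ => N x μ - Nn x μ with hR
    have e1 : curl W N p = curl W Nn p + curl W R p := by
      show curlAt W N p.1 p.2.1.1 p.2.1.2 = curlAt W Nn p.1 p.2.1.1 p.2.1.2 + curlAt W R p.1 p.2.1.1 p.2.1.2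
      have h := curlAt_lincomb W 1 0 Nn Nn R N (fun x μ => by simp only [hR, one_smul, zero_smul, sub_zero, add_sub_cancel]) p.1 p.2.1.1 p.2.1.2
      rw [h, one_smul, zero_smul, sub_zero]
    rw [e1]
    have hR4 : ‖curl W R p‖ ≤ 4 * δ := by
      have h := norm_curlAt_le hW R p.1 p.2.1.1 p.2.1.2
      have := hNN p.1 p.2.1.1; have := hNN (p.1 + e p.2.1.1) p.2.1.2; have := hNN (p.1 + e p.2.1.2) p.2.1.1; have := hNN p.1 p.2.1.2
      show ‖curlAt W R p.1 p.2.1.1 p.2.1.2‖ ≤ 4 * δ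
      linarith
    exact (norm_add_le _ _).trans (add_le_add (haN p hp) hR4)
  intro p hp
  have h := norm_fhol_vary_pathΓ_sub_one_le hW hXs hNs hXα hNα hα hαN Wn hxW hcN hcX ht p hp
  linarith

/-- **POLYNOMIAL FORM of §4**: `… ≤ 2x_W + x_A + 2a_N + 4δ + 48α₀² + 1300(α+α_N)²`. [folklore] -/
theorem small_of_residual_data_poly [Nonempty n] {W : Site d → Fin d → (Matrix n n ℂ)ˣ} (hW : IsUnitaryCfg W)
    {X₀ Nn X N : Site d → Fin d → Matrix n n ℂ} (hX₀s : IsSkewDir X₀) (hXs : IsSkewDir X) (hNs : IsSkewDir N)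
    (hXdef : ∀ (x : Site d) (μ : Fin d), X x μ = Nn x μ - X₀ x μ) {δ : ℝ} (hNN : ∀ (x : Site d) (μ : Fin d), ‖N x μ - Nn x μ‖ ≤ δ)
    {α₀ α αN : ℝ} (hX₀α : ∀ x μ, ‖X₀ x μ‖ ≤ α₀) (hα₀ : α₀ ≤ 1 / 32) (hXα : ∀ x μ, ‖X x μ‖ ≤ α) (hNα : ∀ x μ, ‖N x μ‖ ≤ αN)
    (hα : α ≤ 1 / 32) (hαN : αN ≤ 1 / 64) (Wn : Finset (T4AveragingDeficitWall.Plaq d)) {xW xA aN : ℝ}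
    (hxW : ∀ p ∈ Wn, ‖((fhol W p : (Matrix n n ℂ)ˣ) : Matrix n n ℂ) - 1‖ ≤ xW)
    (hxA : ∀ p ∈ Wn, ‖((fhol (vary W X₀ 1) p : (Matrix n n ℂ)ˣ) : Matrix n n ℂ) - 1‖ ≤ xA)
    (haN : ∀ p ∈ Wn, ‖curl W Nn p‖ ≤ aN) {t : ℝ} (ht : t ∈ Icc (0:ℝ) 1) :
    ∀ p ∈ Wn, ‖((fhol (vary W (pathΓ X N t) 1) p : (Matrix n n ℂ)ˣ) : Matrix n n ℂ) - 1‖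
      ≤ 2 * xW + xA + 2 * aN + 4 * δ + 48 * α₀ ^ 2 + 1300 * (α + αN) ^ 2 := by
  intro p hp
  have h := small_of_residual_data hW hX₀s hXs hNs hXdef hNN hX₀α hα₀ hXα hNα hα hαN Wn hxW hxA haN ht p hp
  have hα0 : 0 ≤ α := (norm_nonneg _).trans (hXα p.1 p.2.1.1)
  have hαN0 : 0 ≤ αN := (norm_nonneg _).trans (hNα p.1 p.2.1.1)
  set b := α + αN with hb
  have hb0 : 0 ≤ b := by rw [hb]; positivity
  have hb1 : 6 * b ≤ 9 / 32 := by rw [hb]; linarith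
  have he2 : (1 - 6 * b) * Real.exp (6 * b) ≤ 1 := one_sub_mul_exp_le_one (6 * b)
  have he1 : Real.exp (6 * b) - 1 ≤ (6 * b) * Real.exp (6 * b) := by nlinarith
  have he3 : Real.exp (6 * b) ≤ 32 / 23 := by nlinarith [Real.exp_pos (6 * b)]
  have htail : 144 * b * (Real.exp (6 * b) - 1) ≤ 1208 * b ^ 2 := by
    have h1 : 144 * b * (Real.exp (6 * b) - 1) ≤ 144 * b * ((6 * b) * Real.exp (6 * b)) :=
      mul_le_mul_of_nonneg_left he1 (by positivity)
    nlinarith [Real.exp_pos (6 * b), sq_nonneg b]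
  linarith

end

end Summit.QuantumFields.BalabanUV.T4Continuum.NE3ProductPathPlaquettes
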